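import Summits.QuantumFields.YangMills.Theorems.BalabanUVNodesN05SubBKnit
import Literature.MathematicalPhysics.QuantumFieldTheory.Balaban1983to89.B8Prop5ExistsZdLan
import Literature.MathematicalPhysics.QuantumFieldTheory.Balaban1983to89.B8Prop5UniqueZdLan

/-!
# BalabanUVNodes ∕ N05 ([B8], `Dag.B8_main`) — THE SubB KNIT WITH PROPOSITION 5's EXISTENCE MEMBER DISCHARGED AT THE `zdLan` FAMILY:
# the surviving [B8] leaf over `IdxB8SubB θ` with Prop. 5's carriers READ as lit-type-B8's member of record `zdLan` over a law-cut index, so that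
# the printed member `p5e` (Prop. 5 (1.107)–(1.108) p. 94) is SUPPLIED by `B8Prop5ExistsZdLan.prop5Exists_zdLan_of_lettersRD` from [4]'s letters

Track A of `YM-PLAN.md` (cell `pub-ymgap`, HUMAN RULING D-0062), node **N05** = [Balaban1985RegularSpaces] Lemma 1, Thm 2, Prop 3, Thm 4, Props 5–7,
Thm 8; R134 fan-out seat `pub-ymgap-dag-n05-c` (g3), answering dag-lead ANSWER-№117(B) «N05 whole-statement module» (INBOX l.14390).  Sequel of
`pub-ymgap-dag-n05-d` g2's `BalabanUVNodesN05SubBKnit.exists_c₁_b8LeafRS_subB_cut_of_knit_lettersRDU` (p468932): that knit displays Proposition 5 as TWO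
abstract members `p5e : B8.Prop5Exists λ.inp.B₀′ λ.B₁ λ.lan`, `p5u : B8.Prop5Unique λ.lan` over the record's RESIDUAL carriers `λ.lan : λ.I8c → B8.LandauData`
(`Node00.CarriersB8.ResidB8`: data, not objects).  THIS MODULE states the SAME knit with Prop. 5's carriers READ AS OBJECTS — the family
`fun a : J => zdLan θ.L λ.B₁ (ι a)` of `B8Prop5LandauDataZd` members (print's datum `(u₁, U₁ = e^{iηA})` with (1.33) ∧ (1.69) ∧ (1.68) ∧ (1.73)–(1.74);
equations (1.107) = Landau OF RECORD (1.38) ∧ (1.29); norm (1.108)) over ANY index map `ι : J → ZdLanIdx θ.D θ.𝔸` whose members obey the two member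
laws (`Ω_{j+1} ⊂ Ω_j`, «Bʲ(y) ⊂ Ω_j»), e.g. the canonical law-cut subtype of `B8Prop5ExistsZdLan.prop5Exists_zdLanSub_of_lettersRD` — and with `p5e` NO
LONGER A HYPOTHESIS: it is this seat's theorem `prop5Exists_zdLan_of_lettersRD` (p478551) from the [4] letters at those members (RD currency, `SLetL`), under
two displayed constant conditions on the record, `2 ≤ λ.B₁` (p. 89) and `3·(2dL²)·B_G·B_R ≤ λ.inp.B₀′∕2` (the free-constant condition at half `B₀′`, so
that (1.108) is strict).  Everything else VERBATIM n05-d's knit (`SLet SLetU SB9all SLetC SB9C`, Prop. 6 discharged at the law-cut cube slot, `p5u p7 t8`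
displayed); proof = n05-d's theorem BY NAME at the record `{λ with I8c := J, lan := zdLan θ.L λ.B₁ ∘ ι}` (its residual Prop-5 slot so pinned; all other
fields and constants of `λ` untouched — definitional).  WHEN the pin owner (node00-def lineage) sets `ResidB8.lan` to this family, the count-line face
follows by `rfl`; until then this is the N05 leaf with ONE FEWER printed member displayed.  Remaining printed members: `p5u` (n05-d g3's uniqueness
twin), `p7`, `t8S`.  HONEST FRAMING: by-name composition; [4]'s letters (three families: law members, their cubes, the Prop-5 members) and the b9
socket are HYPOTHESES ([4] Thms 3.1–3.3 content, N06 lineage); count-neutral; N05 NOT discharged; Bałaban AS PRINTED with locators; one finite 𝕋⁴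
programme at fixed ε; nothing continuum ∕ ℝ⁴ ∕ OS ∕ mass-gap ∕ Clay.  No `sorry`, no new definition.  Unit `pub-ymgap-dag-n05-c` (g3), 2026-08-27.
[cite: Balaban1985RegularSpaces, Prop. 5 (1.107)–(1.108) p.94, p.89; Prop. 6 pp.98–99; Lemma 1 p.79, Thm 2 p.83, Prop. 3 p.87, Thm 4 p.88 (the knit); Prop. 7 p.100, Thm 8 p.101 (named hypotheses); Balaban1985BackgroundPropagators, Thm 3.1 p.397, (3.25) p.394, Thm 3.3 p.398 (letters, hypotheses)]
-/

noncomputable section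

namespace Summit.QuantumFields.YangMills.BalabanUVNodes.N05SubBKnitZdLan

open Literature.MathematicalPhysics.QuantumFieldTheory.Balaban1983to89
open Literature.MathematicalPhysics.QuantumFieldTheory.Balaban1983to89.Node00
open Literature.MathematicalPhysics.QuantumFieldTheory.Balaban1983to89.B8IdxB8LawsB (towerBonds IdxB8LawsB IdxB8SubB famB8OfRecordSubB)
open Literature.MathematicalPhysics.QuantumFieldTheory.Balaban1983to89.B8LeafModelZd (ZdIdx)
open Literature.MathematicalPhysics.QuantumFieldTheory.Balaban1983to89.B8LeafModelZd3 (SockB9P3)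
open Literature.MathematicalPhysics.QuantumFieldTheory.Balaban1983to89.B8SockLettersRD (SockLettersRD)
open Literature.MathematicalPhysics.QuantumFieldTheory.Balaban1983to89.B8LeafKnitRS (B8LeafRS)
open Literature.MathematicalPhysics.QuantumFieldTheory.Balaban1983to89.B8Lemma1NonAbelian (blockPairNA)
open Literature.MathematicalPhysics.QuantumFieldTheory.Balaban1983to89.B8Eq131CubesAdmissible (cubeFam)
open Literature.MathematicalPhysics.QuantumFieldTheory.Balaban1983to89.B8CubeMemberZd (cubeLamS cubeLamB)
open Literature.MathematicalPhysics.QuantumFieldTheory.Balaban1983to89.B8Prop5LandauDataZd (ZdLanIdx zdLan)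
open Literature.MathematicalPhysics.QuantumFieldTheory.Balaban1983to89.B8Prop5ExistsZdLan (prop5Exists_zdLan_of_lettersRD)
open Summit.QuantumFields.YangMills.BalabanUVNodes.N05SubBKnit (exists_c₁_b8LeafRS_subB_cut_of_knit_lettersRDU)
open B7Prop1Explicit B7Prop2Explicit B7Prop1Local
open B8Ineq130 (tlo thi)
open B8Ineq132 (InAk covDerivFwd)
open B7Eq78Linearization (zdBlocking QprimeIter)
open B8Eq119TwistedAxial (bgT)
open B8Eq140Level (SideTouches)
open B8Eq138LandauZd (covLap QT)
open B8Eq1117Concrete (XSpace)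
open B8Prop5ContractionKLevel (Bd2)
open B8LambdaSpaceKLevel (wt)

section Knit

/-- **THE SURVIVING [B8] LEAF OVER `IdxB8SubB θ` WITH PROPOSITION 5's EXISTENCE MEMBER SUPPLIED AT THE `zdLan` FAMILY.**  Setting = n05-d's
`exists_c₁_b8LeafRS_subB_cut_of_knit_lettersRDU` VERBATIM (`λ : ResidB8 θ` with `λ.B₁′ = 5dL·B₀ ≤ λ.B₁`, `2 ≤ 5dL·B₀`, `B₀(β₀) > 0`, `C₂ ≥ 2097152(d+1)²`,
letters constants `B₀′_H, B₂′, B_G, B_R, c_L`, b9 threshold `c_b9`, `3·(2dL²)·B_G·B_R ≤ λ.inp.B₀′`; the letters `SLet`∕`SLetU`∕`SB9all` at the law members and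
`SLetC`∕`SB9C` at their cubes; the printed members `p5u p7 t8`), PLUS Proposition 5's index READ AS OBJECTS: an index map `ι : J → ZdLanIdx θ.D θ.𝔸` with the
member laws `hΩL` ((1.3)) and `htowerL` («Bʲ(y) ⊂ Ω_j», p. 77), the [4] letters at every such member in the RD currency below `c_L` (`SLetL`, the 17 laws of
`SockLettersRD`'s body at `(k, Λ, U₀)` of the member), and the two constant conditions `2 ≤ λ.B₁`, `3·(2dL²)·B_G·B_R ≤ λ.inp.B₀′∕2`.  CONCLUSION: `∃ c₁ > 0` with the
surviving leaf `B8LeafRS` over `fun j : IdxB8SubB θ => famB8OfRecordSubB θ λ.β λ.len j`, Prop. 5's carriers `fun a : J => zdLan θ.L λ.B₁ (ι a)`, Prop. 6 at the cube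
family of record, Prop. 7's axial map `λ.toAxial` — with NO `p5e` hypothesis (it is `B8Prop5ExistsZdLan.prop5Exists_zdLan_of_lettersRD`).  Proof: n05-d's knit at the
record `{λ with I8c := J, lan := fun a => zdLan θ.L λ.B₁ (ι a)}` (definitionally the displayed data).
[cite: Balaban1985RegularSpaces, Prop. 5 (1.107)–(1.108) p.94, Prop. 6 (1.131)–(1.138) pp.98–99, Lemma 1 p.79, Thm 2 p.83, Prop. 3 p.87, Thm 4 p.88; Prop. 7 p.100, Thm 8 p.101 (named hypotheses); Balaban1985BackgroundPropagators, Thm 3.1 p.397, Thm 3.3 p.398, (3.25) p.394 (the letters and the b9 socket, hypotheses)] -/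
theorem exists_c₁_b8LeafRS_subB_cut_zdLan_of_knit_lettersRDU {θ : Stage3Params} (lam : ResidB8 θ) (hD : 2 ≤ θ.D)
    (hB₁' : lam.B₁' = 5 * (θ.D : ℝ) * θ.L * lam.inp.B₀) (hB₁ : 5 * (θ.D : ℝ) * θ.L * lam.inp.B₀ ≤ lam.B₁)
    {cB9 B₀'H B₂' BG BR cL : ℝ} (hB : 2 ≤ 5 * (θ.D : ℝ) * θ.L * lam.inp.B₀) (hB₀β : 0 < lam.B₀β) (hC₂ : 2097152 * ((θ.D : ℝ) + 1) ^ 2 ≤ lam.C₂)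
    (hcB9 : 0 < cB9) (hB₀'H : 0 < B₀'H) (hB₂' : 0 ≤ B₂') (hBG : 0 ≤ BG) (hBR : 0 ≤ BR) (hcL : 0 < cL)
    (hfree : 3 * (2 * (θ.D : ℝ) * (θ.L : ℝ) ^ 2) * BG * BR ≤ lam.inp.B₀')
    -- the two constant conditions of the Prop.-5 provider
    (hB₁2 : 2 ≤ lam.B₁) (hfree2 : 3 * (2 * (θ.D : ℝ) * (θ.L : ℝ) ^ 2) * BG * BR ≤ lam.inp.B₀' / 2)
    -- [4]'s letters at the LAW members: existence side (laws on print's domains) and uniqueness side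
    (SLet : ∀ i : ZdIdx θ.D θ.L, IdxB8LawsB θ.L i → SockLettersRD (𝔸 := θ.𝔸) θ.L BG BR B₀'H B₂' cL i.η i.k i.Ω i.Λs)
    (SLetU : ∀ i : ZdIdx θ.D θ.L, IdxB8LawsB θ.L i → ∀ α₀ : ℝ, 0 < α₀ → α₀ ≤ cL → ∀ U₀ : Site θ.D → Fin θ.D → θ.𝔸ˣ, (∀ x κ, U₀ x κ ∈ unitaryUnits θ.𝔸) →
      InAk θ.L i.k i.η α₀ i.Ω U₀ →
      ∃ (g Δ : (Site θ.D → θ.𝔸) →ₗ[ℂ] (Site θ.D → θ.𝔸)) (q : (Site θ.D → θ.𝔸) →ₗ[ℂ] (ℕ → Site θ.D → θ.𝔸))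
        (qs : (ℕ → Site θ.D → θ.𝔸) →ₗ[ℂ] (Site θ.D → θ.𝔸)) (Aw c : (ℕ → Site θ.D → θ.𝔸) →ₗ[ℂ] (ℕ → Site θ.D → θ.𝔸))
        (H' : XSpace θ.D i.k θ.𝔸 →ₗ[ℂ] (Site θ.D → θ.𝔸)),
        (∀ x, g (Δ x + qs (Aw (q x))) = x) ∧ (∀ φ, qs (c (q (g (g (qs φ))))) = qs φ) ∧
        (∀ (f : Site θ.D → θ.𝔸), ∀ x ∈ i.Ω 0, Δ f x = covLap i.η U₀ ((i.Ω 0).indicator f) x) ∧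
        (∀ (μ : ℕ → Site θ.D → θ.𝔸), ∀ x ∈ i.Ω 0, qs μ x = QT θ.L i.k (i.Λs i.k) U₀ μ x) ∧
        (∀ (f : Site θ.D → θ.𝔸) (n : ℕ), n ≤ i.k → ∀ y ∈ i.Λs i.k n, q f n y = QprimeIter (zdBlocking θ.D θ.L) (bgT θ.L U₀) n f y) ∧
        (∀ (f : Site θ.D → θ.𝔸) (n : ℕ) (y : Site θ.D), ¬ (n ≤ i.k ∧ y ∈ i.Λs i.k n) → q f n y = 0) ∧
        (∀ (X : XSpace θ.D i.k θ.𝔸) (x : Site θ.D), ‖H' X x‖ ≤ B₀'H * ‖X‖) ∧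
        (∀ n, n ≤ i.k → ∀ (X : XSpace θ.D i.k θ.𝔸), ∀ p ∈ {b : Site θ.D × Fin θ.D | SideTouches (i.Ω n) b.1 b.2},
          wt θ.L i.η n * ‖covDerivFwd i.η U₀ p.2 (H' X) p.1‖ ≤ B₀'H * ‖X‖) ∧
        (∀ X : XSpace θ.D i.k θ.𝔸, Bd2 θ.L i.η i.k i.Ω (covLap i.η U₀ (H' X)) (B₂' * ‖X‖)) ∧
        (∀ (Y : XSpace θ.D i.k θ.𝔸) (n : ℕ) (hn : n ≤ i.k) (y : Site θ.D), y ∈ i.Λs i.k n →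
          QprimeIter (zdBlocking θ.D θ.L) (bgT θ.L U₀) n (H' Y) y = Y (⟨n, Nat.lt_succ_of_le hn⟩, y)) ∧
        (∀ (f : Site θ.D → θ.𝔸) (r : ℝ), 0 ≤ r → Bd2 θ.L i.η i.k i.Ω f r →
          (∀ x, ‖g f x‖ ≤ BG * r) ∧ ∀ n, n ≤ i.k → ∀ p ∈ {b : Site θ.D × Fin θ.D | SideTouches (i.Ω n) b.1 b.2},
            wt θ.L i.η n * ‖covDerivFwd i.η U₀ p.2 (g f) p.1‖ ≤ BG * r) ∧
        (∀ (f : Site θ.D → θ.𝔸) (r : ℝ), 0 ≤ r → Bd2 θ.L i.η i.k i.Ω f r → Bd2 θ.L i.η i.k i.Ω (f - g (qs (c (q (g f))))) (BR * r)))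
    (SB9all : ∀ i : ZdIdx θ.D θ.L, IdxB8LawsB θ.L i → ∀ m, m ≤ i.k →
      SockB9P3 (𝔸 := θ.𝔸) θ.L lam.inp.B₀ lam.B₀β cB9 lam.β lam.len i.η m i.Ω i.Λs i.Λb)
    -- AT EVERY CUBE of every law member: the existence letters and the b9 socket at the CUBE geometry (finite-Ω₀ members)
    (SLetC : ∀ i : ZdIdx θ.D θ.L, IdxB8LawsB θ.L i → ∀ c : CubeB8 θ.D θ.L i.k i.Ω,
      SockLettersRD (𝔸 := θ.𝔸) θ.L BG BR B₀'H B₂' cL i.η c.k (cubeFam false θ.L c.a c.M c.ρ c.k) (cubeLamS θ.L c.a c.M c.ρ c.k))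
    (SB9C : ∀ i : ZdIdx θ.D θ.L, IdxB8LawsB θ.L i → ∀ c : CubeB8 θ.D θ.L i.k i.Ω, ∀ m, m ≤ c.k →
      SockB9P3 (𝔸 := θ.𝔸) θ.L lam.inp.B₀ lam.B₀β cB9 lam.β lam.len i.η m (cubeFam false θ.L c.a c.M c.ρ c.k) (cubeLamS θ.L c.a c.M c.ρ c.k)
        (cubeLamB θ.L c.a c.M c.ρ c.k))
    -- PROPOSITION 5's INDEX READ AS OBJECTS: `zdLan` members obeying the member laws, with [4]'s letters at each (RD currency)
    {J : Type} (ι : J → ZdLanIdx θ.D θ.𝔸)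
    (hΩL : ∀ a : J, ∀ j, (ι a).Ω (j + 1) ⊆ (ι a).Ω j)
    (htowerL : ∀ a : J, ∀ j, j ≤ (ι a).k → ∀ y ∈ (ι a).Λ j, ∀ x, InBox (tlo θ.L y j) (thi θ.L y j) x → x ∈ (ι a).Ω j)
    (SLetL : ∀ a : J, ∀ α₀ : ℝ, 0 < α₀ → α₀ ≤ cL → InAk θ.L (ι a).k (ι a).η α₀ (ι a).Ω (ι a).U₀ →
      ∃ (g Δ : (Site θ.D → θ.𝔸) →ₗ[ℂ] (Site θ.D → θ.𝔸)) (q : (Site θ.D → θ.𝔸) →ₗ[ℂ] (ℕ → Site θ.D → θ.𝔸))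
        (qs : (ℕ → Site θ.D → θ.𝔸) →ₗ[ℂ] (Site θ.D → θ.𝔸)) (Aw c : (ℕ → Site θ.D → θ.𝔸) →ₗ[ℂ] (ℕ → Site θ.D → θ.𝔸))
        (H' : XSpace θ.D (ι a).k θ.𝔸 →ₗ[ℂ] (Site θ.D → θ.𝔸)),
        (∀ x, ∀ y ∈ (ι a).Ω 0, (Δ (g x) + qs (Aw (q (g x)))) y = x y) ∧ (∀ f, q (g (g (qs (c (q f))))) = q f) ∧
        (∀ (f : Site θ.D → θ.𝔸), ∀ x ∈ (ι a).Ω 0, Δ f x = covLap (ι a).η (ι a).U₀ (((ι a).Ω 0).indicator f) x) ∧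
        (∀ (μ : ℕ → Site θ.D → θ.𝔸), ∀ x ∈ (ι a).Ω 0, qs μ x = QT θ.L (ι a).k (ι a).Λ (ι a).U₀ μ x) ∧
        (∀ (f : Site θ.D → θ.𝔸) (j : ℕ), j ≤ (ι a).k → ∀ y ∈ (ι a).Λ j, q f j y = QprimeIter (zdBlocking θ.D θ.L) (bgT θ.L (ι a).U₀) j f y) ∧
        (∀ (X : XSpace θ.D (ι a).k θ.𝔸) (x : Site θ.D), ‖H' X x‖ ≤ B₀'H * ‖X‖) ∧
        (∀ j, j ≤ (ι a).k → ∀ (X : XSpace θ.D (ι a).k θ.𝔸), ∀ p ∈ {b : Site θ.D × Fin θ.D | SideTouches ((ι a).Ω j) b.1 b.2},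
          wt θ.L (ι a).η j * ‖covDerivFwd (ι a).η (ι a).U₀ p.2 (H' X) p.1‖ ≤ B₀'H * ‖X‖) ∧
        (∀ X : XSpace θ.D (ι a).k θ.𝔸, Bd2 θ.L (ι a).η (ι a).k (ι a).Ω (covLap (ι a).η (ι a).U₀ (H' X)) (B₂' * ‖X‖)) ∧
        (∀ (X : XSpace θ.D (ι a).k θ.𝔸) (x : Site θ.D), x ∉ (ι a).Ω 0 → H' X x = 0) ∧
        (∀ X Y : XSpace θ.D (ι a).k θ.𝔸, (∀ p, Y p = -star (X p)) → ∀ x, H' Y x = -star (H' X x)) ∧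
        (∀ (Y : XSpace θ.D (ι a).k θ.𝔸) (j : ℕ) (hj : j ≤ (ι a).k) (y : Site θ.D), y ∈ (ι a).Λ j →
          QprimeIter (zdBlocking θ.D θ.L) (bgT θ.L (ι a).U₀) j (H' Y) y = Y (⟨j, Nat.lt_succ_of_le hj⟩, y)) ∧
        (∀ (f : Site θ.D → θ.𝔸) (r : ℝ), 0 ≤ r → Bd2 θ.L (ι a).η (ι a).k (ι a).Ω f r →
          (∀ x, ‖g f x‖ ≤ BG * r) ∧ ∀ j, j ≤ (ι a).k → ∀ p ∈ {b : Site θ.D × Fin θ.D | SideTouches ((ι a).Ω j) b.1 b.2},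
            wt θ.L (ι a).η j * ‖covDerivFwd (ι a).η (ι a).U₀ p.2 (g f) p.1‖ ≤ BG * r) ∧
        (∀ (f : Site θ.D → θ.𝔸) (x : Site θ.D), x ∉ (ι a).Ω 0 → g f x = 0) ∧
        (∀ f : Site θ.D → θ.𝔸, (∀ j, j ≤ (ι a).k → ∀ x ∈ (ι a).Ω j, IsSelfAdjoint (f x)) → ∀ x, IsSelfAdjoint (g f x)) ∧
        (∀ (f : Site θ.D → θ.𝔸) (r : ℝ), 0 ≤ r → Bd2 θ.L (ι a).η (ι a).k (ι a).Ω f r →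
          Bd2 θ.L (ι a).η (ι a).k (ι a).Ω (f - g (qs (c (q (g f))))) (BR * r)) ∧
        (∀ f : Site θ.D → θ.𝔸, (∀ j, j ≤ (ι a).k → ∀ x ∈ (ι a).Ω j, IsSelfAdjoint (f x)) →
          ∀ j, j ≤ (ι a).k → ∀ x ∈ (ι a).Ω j, IsSelfAdjoint ((f - g (qs (c (q (g f))))) x)))
    -- the three remaining printed members
    (p5u : B8.Prop5Unique (fun a : J => zdLan θ.L lam.B₁ (ι a)))
    (p7 : B8SectGH.Prop7PrintedR (fun j : IdxB8SubB θ => famB8OfRecordSubB θ lam.β lam.len j) (fun j => lam.toAxial j.1))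
    (t8 : B8Thm8Surviving.Thm8SurvivingAt 1 lam.B₁ lam.B₂ (fun j : IdxB8SubB θ => famB8OfRecordSubB θ lam.β lam.len j)) :
    ∃ c₁ : ℝ, 0 < c₁ ∧
      B8LeafRS θ.D (θ.L : ℝ) lam.C₂ lam.B₁' lam.inp.B₀' lam.B₁ lam.B₂ c₁ lam.inp lam.B₀β (blockPairNA θ.D θ.L θ.𝔸)
        (fun j : IdxB8SubB θ => famB8OfRecordSubB θ lam.β lam.len j) (fun a : J => zdLan θ.L lam.B₁ (ι a))
        (fun j : IdxB8SubB θ => cubB8OfRecord θ j.1) (fun j => lam.toAxial j.1) := by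
  -- Proposition 5's existence clause at the `zdLan` family, from [4]'s letters there (this seat's provider)
  have p5e : B8.Prop5Exists lam.inp.B₀' lam.B₁ (fun a : J => zdLan θ.L lam.B₁ (ι a)) :=
    prop5Exists_zdLan_of_lettersRD hD θ.two_le_L hB₁2 lam.inp.B₀'_pos hB₀'H hB₂' hBG hBR hcL hfree2 ι hΩL htowerL SLetL
  -- n05-d's knit at the record whose Prop.-5 slot is this family (every other field of `lam` untouched)
  exact exists_c₁_b8LeafRS_subB_cut_of_knit_lettersRDU
    { lam with I8c := J, lan := fun a : J => zdLan θ.L lam.B₁ (ι a) } hD hB₁' hB₁ hB hB₀β hC₂ hcB9 hB₀'H hB₂' hBG hBR hcL hfree SLet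
    SLetU SB9all SLetC SB9C p5e p5u p7 t8

end Knit


/-! ## §2 (v1.1) Both halves of Proposition 5 supplied at the `zdLan` family; uniqueness letters guarded (seat `pub-ymgap-dag-n05-d` g3, APPEND-ONLY) -/

section KnitU

open Literature.MathematicalPhysics.QuantumFieldTheory.Balaban1983to89.B8Prop5UniqueZdLan (prop5Unique_zdLan_of_lettersUB)
open Summit.QuantumFields.YangMills.BalabanUVNodes.N05SubBKnit (exists_c₁_b8LeafRS_subB_cut_of_knit_lettersRDUB)

/-- **(v1.1) THE SURVIVING [B8] LEAF OVER `IdxB8SubB θ` WITH BOTH HALVES OF PROPOSITION 5 SUPPLIED AT THE `zdLan` FAMILY, UNIQUENESS LETTERS GUARDED**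
(seat `pub-ymgap-dag-n05-d` g3, appended at seat n05-c g3's invitation, INBOX 00:58Z 08-27).  §1's `exists_c₁_b8LeafRS_subB_cut_zdLan_of_knit_lettersRDU`
VERBATIM except: (i) the uniqueness-letters binder at the law members is the GUARDED one, `SLetUB` — conjunct 1 = [4]'s left-inverse law of `G′` on BOUNDED
functions ([Balaban1985BackgroundPropagators] Thm 3.1 p. 397 as printed; the total law has no model at `Ω 0 = univ`, INBOX W8″), knit =
`BalabanUVNodesN05SubBKnit.exists_c₁_b8LeafRS_subB_cut_of_knit_lettersRDUB` (v1.2 §3); (ii) Prop. 5's members carry the THIRD member law `Ω 0 = ℤᵈ`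
(`hΩ0L`; the canonical three-law subtype of `B8Prop5ExistsZdLan.prop5Exists_zdLanSub3_of_lettersRD`); (iii) the printed member **`p5u` IS NO LONGER A
HYPOTHESIS**: it is `B8Prop5UniqueZdLan.prop5Unique_zdLan_of_lettersUB` from [4]'s guarded UNIQUENESS letters at those members (`SLetLU`: the knit's
twelve-law family read at `(k, Λ, U₀)` of the member).  Remaining printed members: `p7`, `t8S` (species word); hypotheses otherwise: the four [4]-letters
families (`SLet`, `SLetUB` at the law members; `SLetC` at their cubes; `SLetL`, `SLetLU` at the Prop-5 members), the b9 socket (`SB9all`, `SB9C`), the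
record's constant conditions.  NOT a discharge of N05.
[cite: Balaban1985RegularSpaces, Prop. 5 (1.107)–(1.109) p.94, p.89, Prop. 6 (1.131)–(1.138) pp.98–99, Lemma 1 p.79, Thm 2 p.83, Prop. 3 p.87, Thm 4 p.88; Prop. 7 p.100, Thm 8 p.101 (named hypotheses); Balaban1985BackgroundPropagators, Thm 3.1 p.397, Thm 3.3 p.398, (3.25) p.394 (the letters and the b9 socket, hypotheses)] -/
theorem exists_c₁_b8LeafRS_subB_cut_zdLan_of_knit_lettersRDUB {θ : Stage3Params} (lam : ResidB8 θ) (hD : 2 ≤ θ.D)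
    (hB₁' : lam.B₁' = 5 * (θ.D : ℝ) * θ.L * lam.inp.B₀) (hB₁ : 5 * (θ.D : ℝ) * θ.L * lam.inp.B₀ ≤ lam.B₁)
    {cB9 B₀'H B₂' BG BR cL : ℝ} (hB : 2 ≤ 5 * (θ.D : ℝ) * θ.L * lam.inp.B₀) (hB₀β : 0 < lam.B₀β) (hC₂ : 2097152 * ((θ.D : ℝ) + 1) ^ 2 ≤ lam.C₂)
    (hcB9 : 0 < cB9) (hB₀'H : 0 < B₀'H) (hB₂' : 0 ≤ B₂') (hBG : 0 ≤ BG) (hBR : 0 ≤ BR) (hcL : 0 < cL)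
    (hfree : 3 * (2 * (θ.D : ℝ) * (θ.L : ℝ) ^ 2) * BG * BR ≤ lam.inp.B₀')
    -- the two constant conditions of the Prop.-5 provider
    (hB₁2 : 2 ≤ lam.B₁) (hfree2 : 3 * (2 * (θ.D : ℝ) * (θ.L : ℝ) ^ 2) * BG * BR ≤ lam.inp.B₀' / 2)
    -- [4]'s letters at the LAW members: existence side (laws on print's domains) and uniqueness side
    (SLet : ∀ i : ZdIdx θ.D θ.L, IdxB8LawsB θ.L i → SockLettersRD (𝔸 := θ.𝔸) θ.L BG BR B₀'H B₂' cL i.η i.k i.Ω i.Λs)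
    (SLetUB : ∀ i : ZdIdx θ.D θ.L, IdxB8LawsB θ.L i → ∀ α₀ : ℝ, 0 < α₀ → α₀ ≤ cL → ∀ U₀ : Site θ.D → Fin θ.D → θ.𝔸ˣ, (∀ x κ, U₀ x κ ∈ unitaryUnits θ.𝔸) →
      InAk θ.L i.k i.η α₀ i.Ω U₀ →
      ∃ (g Δ : (Site θ.D → θ.𝔸) →ₗ[ℂ] (Site θ.D → θ.𝔸)) (q : (Site θ.D → θ.𝔸) →ₗ[ℂ] (ℕ → Site θ.D → θ.𝔸))
        (qs : (ℕ → Site θ.D → θ.𝔸) →ₗ[ℂ] (Site θ.D → θ.𝔸)) (Aw c : (ℕ → Site θ.D → θ.𝔸) →ₗ[ℂ] (ℕ → Site θ.D → θ.𝔸))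
        (H' : XSpace θ.D i.k θ.𝔸 →ₗ[ℂ] (Site θ.D → θ.𝔸)),
        (∀ x : Site θ.D → θ.𝔸, (∃ C : ℝ, ∀ y, ‖x y‖ ≤ C) → g (Δ x + qs (Aw (q x))) = x) ∧ (∀ φ, qs (c (q (g (g (qs φ))))) = qs φ) ∧
        (∀ (f : Site θ.D → θ.𝔸), ∀ x ∈ i.Ω 0, Δ f x = covLap i.η U₀ ((i.Ω 0).indicator f) x) ∧
        (∀ (μ : ℕ → Site θ.D → θ.𝔸), ∀ x ∈ i.Ω 0, qs μ x = QT θ.L i.k (i.Λs i.k) U₀ μ x) ∧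
        (∀ (f : Site θ.D → θ.𝔸) (n : ℕ), n ≤ i.k → ∀ y ∈ i.Λs i.k n, q f n y = QprimeIter (zdBlocking θ.D θ.L) (bgT θ.L U₀) n f y) ∧
        (∀ (f : Site θ.D → θ.𝔸) (n : ℕ) (y : Site θ.D), ¬ (n ≤ i.k ∧ y ∈ i.Λs i.k n) → q f n y = 0) ∧
        (∀ (X : XSpace θ.D i.k θ.𝔸) (x : Site θ.D), ‖H' X x‖ ≤ B₀'H * ‖X‖) ∧
        (∀ n, n ≤ i.k → ∀ (X : XSpace θ.D i.k θ.𝔸), ∀ p ∈ {b : Site θ.D × Fin θ.D | SideTouches (i.Ω n) b.1 b.2},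
          wt θ.L i.η n * ‖covDerivFwd i.η U₀ p.2 (H' X) p.1‖ ≤ B₀'H * ‖X‖) ∧
        (∀ X : XSpace θ.D i.k θ.𝔸, Bd2 θ.L i.η i.k i.Ω (covLap i.η U₀ (H' X)) (B₂' * ‖X‖)) ∧
        (∀ (Y : XSpace θ.D i.k θ.𝔸) (n : ℕ) (hn : n ≤ i.k) (y : Site θ.D), y ∈ i.Λs i.k n →
          QprimeIter (zdBlocking θ.D θ.L) (bgT θ.L U₀) n (H' Y) y = Y (⟨n, Nat.lt_succ_of_le hn⟩, y)) ∧
        (∀ (f : Site θ.D → θ.𝔸) (r : ℝ), 0 ≤ r → Bd2 θ.L i.η i.k i.Ω f r →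
          (∀ x, ‖g f x‖ ≤ BG * r) ∧ ∀ n, n ≤ i.k → ∀ p ∈ {b : Site θ.D × Fin θ.D | SideTouches (i.Ω n) b.1 b.2},
            wt θ.L i.η n * ‖covDerivFwd i.η U₀ p.2 (g f) p.1‖ ≤ BG * r) ∧
        (∀ (f : Site θ.D → θ.𝔸) (r : ℝ), 0 ≤ r → Bd2 θ.L i.η i.k i.Ω f r → Bd2 θ.L i.η i.k i.Ω (f - g (qs (c (q (g f))))) (BR * r)))
    (SB9all : ∀ i : ZdIdx θ.D θ.L, IdxB8LawsB θ.L i → ∀ m, m ≤ i.k →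
      SockB9P3 (𝔸 := θ.𝔸) θ.L lam.inp.B₀ lam.B₀β cB9 lam.β lam.len i.η m i.Ω i.Λs i.Λb)
    -- AT EVERY CUBE of every law member: the existence letters and the b9 socket at the CUBE geometry (finite-Ω₀ members)
    (SLetC : ∀ i : ZdIdx θ.D θ.L, IdxB8LawsB θ.L i → ∀ c : CubeB8 θ.D θ.L i.k i.Ω,
      SockLettersRD (𝔸 := θ.𝔸) θ.L BG BR B₀'H B₂' cL i.η c.k (cubeFam false θ.L c.a c.M c.ρ c.k) (cubeLamS θ.L c.a c.M c.ρ c.k))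
    (SB9C : ∀ i : ZdIdx θ.D θ.L, IdxB8LawsB θ.L i → ∀ c : CubeB8 θ.D θ.L i.k i.Ω, ∀ m, m ≤ c.k →
      SockB9P3 (𝔸 := θ.𝔸) θ.L lam.inp.B₀ lam.B₀β cB9 lam.β lam.len i.η m (cubeFam false θ.L c.a c.M c.ρ c.k) (cubeLamS θ.L c.a c.M c.ρ c.k)
        (cubeLamB θ.L c.a c.M c.ρ c.k))
    -- PROPOSITION 5's INDEX READ AS OBJECTS: `zdLan` members obeying the member laws, with [4]'s letters at each (RD currency)
    {J : Type} (ι : J → ZdLanIdx θ.D θ.𝔸)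
    (hΩ0L : ∀ a : J, (ι a).Ω 0 = Set.univ) (hΩL : ∀ a : J, ∀ j, (ι a).Ω (j + 1) ⊆ (ι a).Ω j)
    (htowerL : ∀ a : J, ∀ j, j ≤ (ι a).k → ∀ y ∈ (ι a).Λ j, ∀ x, InBox (tlo θ.L y j) (thi θ.L y j) x → x ∈ (ι a).Ω j)
    (SLetL : ∀ a : J, ∀ α₀ : ℝ, 0 < α₀ → α₀ ≤ cL → InAk θ.L (ι a).k (ι a).η α₀ (ι a).Ω (ι a).U₀ →
      ∃ (g Δ : (Site θ.D → θ.𝔸) →ₗ[ℂ] (Site θ.D → θ.𝔸)) (q : (Site θ.D → θ.𝔸) →ₗ[ℂ] (ℕ → Site θ.D → θ.𝔸))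
        (qs : (ℕ → Site θ.D → θ.𝔸) →ₗ[ℂ] (Site θ.D → θ.𝔸)) (Aw c : (ℕ → Site θ.D → θ.𝔸) →ₗ[ℂ] (ℕ → Site θ.D → θ.𝔸))
        (H' : XSpace θ.D (ι a).k θ.𝔸 →ₗ[ℂ] (Site θ.D → θ.𝔸)),
        (∀ x, ∀ y ∈ (ι a).Ω 0, (Δ (g x) + qs (Aw (q (g x)))) y = x y) ∧ (∀ f, q (g (g (qs (c (q f))))) = q f) ∧
        (∀ (f : Site θ.D → θ.𝔸), ∀ x ∈ (ι a).Ω 0, Δ f x = covLap (ι a).η (ι a).U₀ (((ι a).Ω 0).indicator f) x) ∧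
        (∀ (μ : ℕ → Site θ.D → θ.𝔸), ∀ x ∈ (ι a).Ω 0, qs μ x = QT θ.L (ι a).k (ι a).Λ (ι a).U₀ μ x) ∧
        (∀ (f : Site θ.D → θ.𝔸) (j : ℕ), j ≤ (ι a).k → ∀ y ∈ (ι a).Λ j, q f j y = QprimeIter (zdBlocking θ.D θ.L) (bgT θ.L (ι a).U₀) j f y) ∧
        (∀ (X : XSpace θ.D (ι a).k θ.𝔸) (x : Site θ.D), ‖H' X x‖ ≤ B₀'H * ‖X‖) ∧
        (∀ j, j ≤ (ι a).k → ∀ (X : XSpace θ.D (ι a).k θ.𝔸), ∀ p ∈ {b : Site θ.D × Fin θ.D | SideTouches ((ι a).Ω j) b.1 b.2},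
          wt θ.L (ι a).η j * ‖covDerivFwd (ι a).η (ι a).U₀ p.2 (H' X) p.1‖ ≤ B₀'H * ‖X‖) ∧
        (∀ X : XSpace θ.D (ι a).k θ.𝔸, Bd2 θ.L (ι a).η (ι a).k (ι a).Ω (covLap (ι a).η (ι a).U₀ (H' X)) (B₂' * ‖X‖)) ∧
        (∀ (X : XSpace θ.D (ι a).k θ.𝔸) (x : Site θ.D), x ∉ (ι a).Ω 0 → H' X x = 0) ∧
        (∀ X Y : XSpace θ.D (ι a).k θ.𝔸, (∀ p, Y p = -star (X p)) → ∀ x, H' Y x = -star (H' X x)) ∧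
        (∀ (Y : XSpace θ.D (ι a).k θ.𝔸) (j : ℕ) (hj : j ≤ (ι a).k) (y : Site θ.D), y ∈ (ι a).Λ j →
          QprimeIter (zdBlocking θ.D θ.L) (bgT θ.L (ι a).U₀) j (H' Y) y = Y (⟨j, Nat.lt_succ_of_le hj⟩, y)) ∧
        (∀ (f : Site θ.D → θ.𝔸) (r : ℝ), 0 ≤ r → Bd2 θ.L (ι a).η (ι a).k (ι a).Ω f r →
          (∀ x, ‖g f x‖ ≤ BG * r) ∧ ∀ j, j ≤ (ι a).k → ∀ p ∈ {b : Site θ.D × Fin θ.D | SideTouches ((ι a).Ω j) b.1 b.2},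
            wt θ.L (ι a).η j * ‖covDerivFwd (ι a).η (ι a).U₀ p.2 (g f) p.1‖ ≤ BG * r) ∧
        (∀ (f : Site θ.D → θ.𝔸) (x : Site θ.D), x ∉ (ι a).Ω 0 → g f x = 0) ∧
        (∀ f : Site θ.D → θ.𝔸, (∀ j, j ≤ (ι a).k → ∀ x ∈ (ι a).Ω j, IsSelfAdjoint (f x)) → ∀ x, IsSelfAdjoint (g f x)) ∧
        (∀ (f : Site θ.D → θ.𝔸) (r : ℝ), 0 ≤ r → Bd2 θ.L (ι a).η (ι a).k (ι a).Ω f r →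
          Bd2 θ.L (ι a).η (ι a).k (ι a).Ω (f - g (qs (c (q (g f))))) (BR * r)) ∧
        (∀ f : Site θ.D → θ.𝔸, (∀ j, j ≤ (ι a).k → ∀ x ∈ (ι a).Ω j, IsSelfAdjoint (f x)) →
          ∀ j, j ≤ (ι a).k → ∀ x ∈ (ι a).Ω j, IsSelfAdjoint ((f - g (qs (c (q (g f))))) x)))
    -- [4]'s UNIQUENESS letters at the Prop-5 members (left-inverse law of G′ on bounded functions), for Prop. 5's uniqueness clause there
    (SLetLU : ∀ a : J, ∀ α₀ : ℝ, 0 < α₀ → α₀ ≤ cL → InAk θ.L (ι a).k (ι a).η α₀ (ι a).Ω (ι a).U₀ →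
      ∃ (g Δ : (Site θ.D → θ.𝔸) →ₗ[ℂ] (Site θ.D → θ.𝔸)) (q : (Site θ.D → θ.𝔸) →ₗ[ℂ] (ℕ → Site θ.D → θ.𝔸)) (qs : (ℕ → Site θ.D → θ.𝔸) →ₗ[ℂ] (Site θ.D → θ.𝔸))
        (Aw c : (ℕ → Site θ.D → θ.𝔸) →ₗ[ℂ] (ℕ → Site θ.D → θ.𝔸)) (H' : XSpace θ.D (ι a).k θ.𝔸 →ₗ[ℂ] (Site θ.D → θ.𝔸)),
        (∀ x : Site θ.D → θ.𝔸, (∃ C : ℝ, ∀ y, ‖x y‖ ≤ C) → g (Δ x + qs (Aw (q x))) = x) ∧ (∀ φ, qs (c (q (g (g (qs φ))))) = qs φ) ∧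
        (∀ (f : Site θ.D → θ.𝔸), ∀ x ∈ (ι a).Ω 0, Δ f x = covLap (ι a).η (ι a).U₀ (((ι a).Ω 0).indicator f) x) ∧
        (∀ (μ : ℕ → Site θ.D → θ.𝔸), ∀ x ∈ (ι a).Ω 0, qs μ x = QT θ.L (ι a).k (ι a).Λ (ι a).U₀ μ x) ∧
        (∀ (f : Site θ.D → θ.𝔸) (n : ℕ), n ≤ (ι a).k → ∀ y ∈ (ι a).Λ n, q f n y = QprimeIter (zdBlocking θ.D θ.L) (bgT θ.L (ι a).U₀) n f y) ∧
        (∀ (f : Site θ.D → θ.𝔸) (n : ℕ) (y : Site θ.D), ¬ (n ≤ (ι a).k ∧ y ∈ (ι a).Λ n) → q f n y = 0) ∧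
        (∀ (X : XSpace θ.D (ι a).k θ.𝔸) (x : Site θ.D), ‖H' X x‖ ≤ B₀'H * ‖X‖) ∧
        (∀ n, n ≤ (ι a).k → ∀ (X : XSpace θ.D (ι a).k θ.𝔸), ∀ p ∈ {b : Site θ.D × Fin θ.D | SideTouches ((ι a).Ω n) b.1 b.2},
          wt θ.L (ι a).η n * ‖covDerivFwd (ι a).η (ι a).U₀ p.2 (H' X) p.1‖ ≤ B₀'H * ‖X‖) ∧
        (∀ X : XSpace θ.D (ι a).k θ.𝔸, Bd2 θ.L (ι a).η (ι a).k (ι a).Ω (covLap (ι a).η (ι a).U₀ (H' X)) (B₂' * ‖X‖)) ∧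
        (∀ (Y : XSpace θ.D (ι a).k θ.𝔸) (n : ℕ) (hn : n ≤ (ι a).k) (y : Site θ.D), y ∈ (ι a).Λ n →
          QprimeIter (zdBlocking θ.D θ.L) (bgT θ.L (ι a).U₀) n (H' Y) y = Y (⟨n, Nat.lt_succ_of_le hn⟩, y)) ∧
        (∀ (f : Site θ.D → θ.𝔸) (r : ℝ), 0 ≤ r → Bd2 θ.L (ι a).η (ι a).k (ι a).Ω f r →
          (∀ x, ‖g f x‖ ≤ BG * r) ∧ ∀ n, n ≤ (ι a).k → ∀ p ∈ {b : Site θ.D × Fin θ.D | SideTouches ((ι a).Ω n) b.1 b.2},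
            wt θ.L (ι a).η n * ‖covDerivFwd (ι a).η (ι a).U₀ p.2 (g f) p.1‖ ≤ BG * r) ∧
        (∀ (f : Site θ.D → θ.𝔸) (r : ℝ), 0 ≤ r → Bd2 θ.L (ι a).η (ι a).k (ι a).Ω f r →
          Bd2 θ.L (ι a).η (ι a).k (ι a).Ω (f - g (qs (c (q (g f))))) (BR * r)))
    -- the two remaining printed members
    (p7 : B8SectGH.Prop7PrintedR (fun j : IdxB8SubB θ => famB8OfRecordSubB θ lam.β lam.len j) (fun j => lam.toAxial j.1))
    (t8 : B8Thm8Surviving.Thm8SurvivingAt 1 lam.B₁ lam.B₂ (fun j : IdxB8SubB θ => famB8OfRecordSubB θ lam.β lam.len j)) :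
    ∃ c₁ : ℝ, 0 < c₁ ∧
      B8LeafRS θ.D (θ.L : ℝ) lam.C₂ lam.B₁' lam.inp.B₀' lam.B₁ lam.B₂ c₁ lam.inp lam.B₀β (blockPairNA θ.D θ.L θ.𝔸)
        (fun j : IdxB8SubB θ => famB8OfRecordSubB θ lam.β lam.len j) (fun a : J => zdLan θ.L lam.B₁ (ι a))
        (fun j : IdxB8SubB θ => cubB8OfRecord θ j.1) (fun j => lam.toAxial j.1) := by
  -- Proposition 5's existence clause at the `zdLan` family, from [4]'s letters there (this seat's provider)
  have p5e : B8.Prop5Exists lam.inp.B₀' lam.B₁ (fun a : J => zdLan θ.L lam.B₁ (ι a)) :=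
    prop5Exists_zdLan_of_lettersRD hD θ.two_le_L hB₁2 lam.inp.B₀'_pos hB₀'H hB₂' hBG hBR hcL hfree2 ι hΩL htowerL SLetL
  -- Proposition 5's uniqueness clause at the `zdLan` family, from [4]'s guarded uniqueness letters there (seat n05-d's provider)
  have p5u : B8.Prop5Unique (fun a : J => zdLan θ.L lam.B₁ (ι a)) :=
    prop5Unique_zdLan_of_lettersUB hD θ.two_le_L (le_trans (by norm_num) hB₁2) hB₀'H hB₂' hBG hBR hcL ι hΩ0L hΩL htowerL SLetLU
  -- n05-d's GUARDED knit (v1.2 §3) at the record whose Prop.-5 slot is this family (every other field of `lam` untouched)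
  exact exists_c₁_b8LeafRS_subB_cut_of_knit_lettersRDUB
    { lam with I8c := J, lan := fun a : J => zdLan θ.L lam.B₁ (ι a) } hD hB₁' hB₁ hB hB₀β hC₂ hcB9 hB₀'H hB₂' hBG hBR hcL hfree SLet
    SLetUB SB9all SLetC SB9C p5e p5u p7 t8


end KnitU

#print axioms exists_c₁_b8LeafRS_subB_cut_zdLan_of_knit_lettersRDUB

end Summit.QuantumFields.YangMills.BalabanUVNodes.N05SubBKnitZdLan

end
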